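import Summits.Ventures.HodgeRepro2.Hypothesis
import Summits.Ventures.HodgeRepro2.Signs

/-!
# Unitary reflections: involutions of `U(H)(K)` for every hermitian form `H`

For a hermitian form `H` on `K^m` over the CM field `K` (`IsHermitianForm K H`, i.e. `H* = H` for the
conjugate transpose `conjTransposeK`) and a vector `v` with `v* H v ≠ 0`, the *unitary reflection*

  `r_v = 1 − (2 / v* H v) · v (v* H)`

lies in the unitary group `U(H)(K) = {g : g* H g = H}`, satisfies `r_v² = 1`, `r_v v = −v`,
`det r_v = −1` and `tr r_v = m − 2`; its negative `−r_v` has determinant `(−1)^{m−1}` and so lies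
in `SU(H)(K)` when `m` is odd (our case `m = 3`).  A vector with `v* H v ≠ 0` exists as soon as
`H ≠ 0`.  These are the classical elements of order two of a unitary group; they provide, for EVERY
subgroup `S ≤ GL_3(K)`, rational unitary elements `δ` with `δ² = 1` — hence `δ⁻¹ ∈ S δ S`, the
hypothesis of the self-adjoint Hecke operators of the (N)-period chain (rows 137–149 of the p2 annex:
`inv_mem_doubleCoset_of_sq_mem`).  Everything here is elementary matrix algebra over `K`.

Conventions: column vectors, `hermDot H x y = x* H y = Σ ρ(x_i) H_{ij} y_j` (so that the unitary
group acts by `g : y ↦ g y`, matching `unitaryGroup`), `ρ = complex conjugation of the CM field`.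
-/

namespace Summit.Ventures.HodgeRepro2.ShimuraData

open Matrix

noncomputable section

variable {K : Type*} [Field K] [NumberField K] [NumberField.IsCMField K] {m : ℕ}

/-- Complex conjugation of the CM field is an involution: `ρ (ρ x) = x`. -/
lemma ρ_ρ (x : K) : ρ K (ρ K x) = x :=
  NumberField.IsCMField.complexConj_apply_apply K x

/-- The hermitian pairing `x* H y = Σ_{i,j} ρ(x_i) H_{ij} y_j` attached to a matrix `H`
(column-vector convention, matching `unitaryGroup`: `g* H g = H`). -/
def hermDot (H : Matrix (Fin m) (Fin m) K) (x y : Fin m → K) : K :=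
  (fun i => ρ K (x i)) ⬝ᵥ (H *ᵥ y)

/-- The row vector `v* H`. -/
def conjRow (H : Matrix (Fin m) (Fin m) K) (v : Fin m → K) : Fin m → K :=
  (fun i => ρ K (v i)) ᵥ* H

/-- `x* H y = (x* H) · y`. -/
lemma hermDot_eq_conjRow_dotProduct (H : Matrix (Fin m) (Fin m) K) (x y : Fin m → K) :
    hermDot H x y = conjRow H x ⬝ᵥ y := by
  unfold hermDot conjRow
  exact dotProduct_mulVec _ _ _

/-- `(v* H) · v = v* H v`. -/
lemma conjRow_dotProduct_self (H : Matrix (Fin m) (Fin m) K) (v : Fin m → K) :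
    conjRow H v ⬝ᵥ v = hermDot H v v :=
  (hermDot_eq_conjRow_dotProduct H v v).symm

/-- Additivity of the pairing in the first variable. -/
lemma hermDot_add_left (H : Matrix (Fin m) (Fin m) K) (x y z : Fin m → K) :
    hermDot H (x + y) z = hermDot H x z + hermDot H y z := by
  unfold hermDot
  have : (fun i => ρ K ((x + y) i)) = (fun i => ρ K (x i)) + (fun i => ρ K (y i)) := by
    funext i; simp [map_add]
  rw [this, add_dotProduct]

/-- Additivity of the pairing in the second variable. -/
lemma hermDot_add_right (H : Matrix (Fin m) (Fin m) K) (x y z : Fin m → K) :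
    hermDot H x (y + z) = hermDot H x y + hermDot H x z := by
  unfold hermDot
  rw [mulVec_add, dotProduct_add]

/-- Conjugate-linearity of the pairing in the first variable. -/
lemma hermDot_smul_left (H : Matrix (Fin m) (Fin m) K) (t : K) (x y : Fin m → K) :
    hermDot H (t • x) y = ρ K t * hermDot H x y := by
  unfold hermDot
  have : (fun i => ρ K ((t • x) i)) = ρ K t • (fun i => ρ K (x i)) := by
    funext i; simp [map_mul]
  rw [this, smul_dotProduct, smul_eq_mul]

/-- Linearity of the pairing in the second variable. -/
lemma hermDot_smul_right (H : Matrix (Fin m) (Fin m) K) (t : K) (x y : Fin m → K) :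
    hermDot H x (t • y) = t * hermDot H x y := by
  unfold hermDot
  rw [mulVec_smul, dotProduct_smul, smul_eq_mul]

/-- The pairing of two coordinate vectors is the matrix entry: `e_i* H e_j = H_{ij}`. -/
lemma hermDot_single_single (H : Matrix (Fin m) (Fin m) K) (i j : Fin m) :
    hermDot H (Pi.single i 1) (Pi.single j 1) = H i j := by
  unfold hermDot
  rw [mulVec_single_one]
  simp [dotProduct, Pi.single_apply, Matrix.col]

/-- Expansion of `(x + t y)* H (x + t y)`. -/
lemma hermDot_add_smul_self (H : Matrix (Fin m) (Fin m) K) (t : K) (x y : Fin m → K) :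
    hermDot H (x + t • y) (x + t • y) =
      hermDot H x x + t * hermDot H x y + ρ K t * hermDot H y x +
        ρ K t * t * hermDot H y y := by
  rw [hermDot_add_left, hermDot_add_right, hermDot_add_right, hermDot_smul_left,
    hermDot_smul_right, hermDot_smul_left, hermDot_smul_right]
  ring

/-- A non-zero matrix has a vector `v` with `v* H v ≠ 0` (no hermitian hypothesis is needed: the
polarisation identity with `t = 1` and with `t = η` purely imaginary recovers every entry). -/
theorem exists_hermDot_self_ne_zero {H : Matrix (Fin m) (Fin m) K} (h0 : H ≠ 0) :
    ∃ v : Fin m → K, hermDot H v v ≠ 0 := by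
  by_contra hne
  have hcon : ∀ v : Fin m → K, hermDot H v v = 0 := fun v => not_not.mp fun hv => hne ⟨v, hv⟩
  apply h0
  obtain ⟨η, hη, hη0⟩ := exists_imaginary_ne_zero K
  ext i j
  have hii : H i i = 0 := by
    have := hcon (Pi.single i 1)
    rwa [hermDot_single_single] at this
  have hjj : H j j = 0 := by
    have := hcon (Pi.single j 1)
    rwa [hermDot_single_single] at this
  have e1 := hcon (Pi.single i 1 + (1 : K) • Pi.single j 1)
  rw [hermDot_add_smul_self, hermDot_single_single, hermDot_single_single,
    hermDot_single_single, hermDot_single_single, map_one] at e1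
  have e2 := hcon (Pi.single i 1 + η • Pi.single j 1)
  rw [hermDot_add_smul_self, hermDot_single_single, hermDot_single_single,
    hermDot_single_single, hermDot_single_single, hη] at e2
  have h3 : η * (H i j - H j i) = 0 := by
    linear_combination e2 - hii + η * η * hjj
  have h4 : H i j - H j i = 0 := by
    rcases mul_eq_zero.mp h3 with h | h
    · exact absurd h hη0
    · exact h
  have h5 : (2 : K) * H i j = 0 := by
    linear_combination e1 - hii - hjj + h4
  rcases mul_eq_zero.mp h5 with h | h
  · exact absurd h two_ne_zero
  · simpa using h

/-- Entrywise form of `H* = H`: `ρ (H i j) = H j i`. -/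
lemma ρ_apply_of_isHermitianForm {H : Matrix (Fin m) (Fin m) K} (hH : IsHermitianForm K H)
    (i j : Fin m) : ρ K (H i j) = H j i := by
  have h := hH
  unfold IsHermitianForm conjTransposeK at h
  have := congrFun (congrFun h j) i
  simpa [transpose_apply, map_apply] using this

/-- The pairing is conjugate-symmetric for a hermitian `H`: `ρ (x* H y) = y* H x`. -/
lemma ρ_hermDot {H : Matrix (Fin m) (Fin m) K} (hH : IsHermitianForm K H) (x y : Fin m → K) :
    ρ K (hermDot H x y) = hermDot H y x := by
  unfold hermDot
  simp only [dotProduct, mulVec, map_sum, map_mul, ρ_ρ, ρ_apply_of_isHermitianForm hH, Finset.mul_sum]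
  rw [Finset.sum_comm]
  refine Finset.sum_congr rfl fun j _ => Finset.sum_congr rfl fun i _ => ?_
  ring

/-- `v* H v` is fixed by conjugation for a hermitian `H`. -/
lemma ρ_hermDot_self {H : Matrix (Fin m) (Fin m) K} (hH : IsHermitianForm K H) (v : Fin m → K) :
    ρ K (hermDot H v v) = hermDot H v v :=
  ρ_hermDot hH v v

/-- Conjugating the row `v* H` gives the column `H v` (for `H` hermitian). -/
lemma ρ_conjRow {H : Matrix (Fin m) (Fin m) K} (hH : IsHermitianForm K H) (v : Fin m → K) :
    (fun j => ρ K (conjRow H v j)) = H *ᵥ v := by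
  funext j
  unfold conjRow
  simp only [vecMul, mulVec, dotProduct, map_sum, map_mul, ρ_ρ, ρ_apply_of_isHermitianForm hH]
  refine Finset.sum_congr rfl fun i _ => ?_
  ring

/-! ### The conjugate transpose of the relevant matrices -/

/-- `(A − B)* = A* − B*`. -/
lemma conjTransposeK_sub (A B : Matrix (Fin m) (Fin m) K) :
    conjTransposeK K (A - B) = conjTransposeK K A - conjTransposeK K B := by
  ext i j; simp [conjTransposeK, map_sub]

/-- `(−A)* = −A*`. -/
lemma conjTransposeK_neg (A : Matrix (Fin m) (Fin m) K) :
    conjTransposeK K (-A) = -conjTransposeK K A := by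
  ext i j; simp [conjTransposeK, map_neg]

/-- `(a A)* = ρ(a) A*`. -/
lemma conjTransposeK_smul (a : K) (A : Matrix (Fin m) (Fin m) K) :
    conjTransposeK K (a • A) = ρ K a • conjTransposeK K A := by
  ext i j; simp [conjTransposeK, map_mul]

/-- `(x y^T)* = ρ(y) ρ(x)^T`. -/
lemma conjTransposeK_vecMulVec (x y : Fin m → K) :
    conjTransposeK K (vecMulVec x y) = vecMulVec (fun i => ρ K (y i)) (fun i => ρ K (x i)) := by
  ext i j; simp [conjTransposeK, vecMulVec_apply, map_mul, mul_comm]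

/-! ### The reflection -/

/-- The unitary reflection attached to `v`: `r_v = 1 − (2 / v* H v) · v (v* H)`. -/
def reflection (H : Matrix (Fin m) (Fin m) K) (v : Fin m → K) : Matrix (Fin m) (Fin m) K :=
  1 - (2 / hermDot H v v) • vecMulVec v (conjRow H v)

/-- `r_v v = −v`. -/
theorem reflection_mulVec_self {H : Matrix (Fin m) (Fin m) K} {v : Fin m → K}
    (hc : hermDot H v v ≠ 0) : reflection H v *ᵥ v = -v := by
  unfold reflection
  rw [sub_mulVec, one_mulVec, smul_mulVec, vecMulVec_mulVec, conjRow_dotProduct_self,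
    op_smul_eq_smul, smul_smul, div_mul_cancel₀ _ hc, two_smul]
  abel

/-- `r_v u = u` for `u` orthogonal to `v` (`v* H u = 0`). -/
theorem reflection_mulVec_of_hermDot_eq_zero (H : Matrix (Fin m) (Fin m) K) (v u : Fin m → K)
    (hu : hermDot H v u = 0) : reflection H v *ᵥ u = u := by
  unfold reflection
  rw [sub_mulVec, one_mulVec, smul_mulVec, vecMulVec_mulVec, ← hermDot_eq_conjRow_dotProduct, hu]
  simp

/-- `r_v² = 1`. -/
theorem reflection_mul_self {H : Matrix (Fin m) (Fin m) K} {v : Fin m → K}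
    (hc : hermDot H v v ≠ 0) : reflection H v * reflection H v = 1 := by
  set c := hermDot H v v with hc_def
  set a : K := 2 / c with ha
  set P := vecMulVec v (conjRow H v) with hP
  have hPP : P * P = c • P := by
    rw [hP, vecMulVec_mul_vecMulVec, conjRow_dotProduct_self, vecMulVec_smul]
  have hac : a * (a * c) = 2 * a := by
    rw [ha, div_mul_cancel₀ _ hc, mul_comm]
  have hr : reflection H v = 1 - a • P := by
    unfold reflection; rw [← hc_def, ← ha, ← hP]
  rw [hr]
  simp only [sub_mul, mul_sub, one_mul, mul_one, Matrix.smul_mul, Matrix.mul_smul, hPP, smul_smul]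
  rw [hac, two_mul, add_smul]
  abel

/-- `r_v* H r_v = H`: the reflection is unitary for the hermitian form `H`. -/
theorem conjTransposeK_reflection_mul_mul {H : Matrix (Fin m) (Fin m) K} (hH : IsHermitianForm K H)
    {v : Fin m → K} (hc : hermDot H v v ≠ 0) :
    conjTransposeK K (reflection H v) * H * reflection H v = H := by
  set c := hermDot H v v with hc_def
  set a : K := 2 / c with ha
  set w := conjRow H v with hw
  set P := vecMulVec v w with hP
  set M := vecMulVec (H *ᵥ v) w with hM
  have hρa : ρ K a = a := by
    rw [ha, map_div₀, map_ofNat, ρ_hermDot_self hH]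
  have hac : a * (a * c) = 2 * a := by
    rw [ha, div_mul_cancel₀ _ hc, mul_comm]
  have hQ : conjTransposeK K P = vecMulVec (H *ᵥ v) (fun i => ρ K (v i)) := by
    rw [hP, conjTransposeK_vecMulVec, hw, ρ_conjRow hH]
  have hQH : vecMulVec (H *ᵥ v) (fun i => ρ K (v i)) * H = M := by
    rw [hM, vecMulVec_mul]; rfl
  have hHP : H * P = M := by
    rw [hP, hM, mul_vecMulVec]
  have hMP : M * P = c • M := by
    rw [hM, hP, vecMulVec_mul_vecMulVec, hw, conjRow_dotProduct_self, ← hc_def, vecMulVec_smul]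
  have hr : reflection H v = 1 - a • P := by
    unfold reflection; rw [← hc_def, ← ha, ← hw, ← hP]
  rw [hr, conjTransposeK_sub, conjTransposeK_one, conjTransposeK_smul, hρa, hQ]
  simp only [sub_mul, mul_sub, one_mul, mul_one, Matrix.smul_mul, Matrix.mul_smul, hQH, hHP, hMP,
    smul_smul]
  rw [hac, two_mul, add_smul]
  abel

/-- `tr r_v = m − 2`. -/
theorem trace_reflection {H : Matrix (Fin m) (Fin m) K} {v : Fin m → K}
    (hc : hermDot H v v ≠ 0) : (reflection H v).trace = (m : K) - 2 := by
  unfold reflection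
  rw [trace_sub, trace_one, trace_smul, trace_vecMulVec, dotProduct_comm, conjRow_dotProduct_self,
    smul_eq_mul, div_mul_cancel₀ _ hc, Fintype.card_fin]

omit [NumberField K] [NumberField.IsCMField K] in
/-- The determinant of `1 − a · v wᵀ` is `1 − a (w · v)` (the matrix determinant lemma, via the
Weinstein–Aronszajn identity for a `m × 1` by `1 × m` product). -/
theorem det_one_sub_smul_vecMulVec (a : K) (v w : Fin m → K) :
    (1 - a • vecMulVec v w).det = 1 - a * (w ⬝ᵥ v) := by
  let A : Matrix (Fin m) (Fin 1) K := fun i _ => a * v i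
  let B : Matrix (Fin 1) (Fin m) K := fun _ j => w j
  have hAB : A * B = a • vecMulVec v w := by
    ext i j; simp [A, B, mul_apply, vecMulVec_apply, mul_assoc]
  have hBA : B * A = Matrix.of fun _ _ => a * (w ⬝ᵥ v) := by
    ext i j; simp [A, B, mul_apply, dotProduct, Finset.mul_sum, mul_left_comm]
  rw [← hAB, det_one_sub_mul_comm, hBA, det_fin_one]
  simp

/-- `det r_v = −1`. -/
theorem det_reflection {H : Matrix (Fin m) (Fin m) K} {v : Fin m → K}
    (hc : hermDot H v v ≠ 0) : (reflection H v).det = -1 := by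
  unfold reflection
  rw [det_one_sub_smul_vecMulVec, conjRow_dotProduct_self, div_mul_cancel₀ _ hc]
  norm_num

/-- `r_v ≠ 1` (for `m ≠ 1`... in fact for every `m`, since `tr r_v = m − 2 ≠ m`). -/
theorem reflection_ne_one {H : Matrix (Fin m) (Fin m) K} {v : Fin m → K}
    (hc : hermDot H v v ≠ 0) : reflection H v ≠ 1 := by
  intro h
  have := trace_reflection hc
  rw [h, trace_one, Fintype.card_fin] at this
  have h2 : (2 : K) = 0 := by linear_combination this
  exact two_ne_zero h2

/-- `r_v ≠ −1` as soon as `m ≠ 1` (`tr r_v = m − 2 ≠ −m`). -/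
theorem reflection_ne_neg_one {H : Matrix (Fin m) (Fin m) K} {v : Fin m → K}
    (hc : hermDot H v v ≠ 0) (hm : m ≠ 1) : reflection H v ≠ -1 := by
  intro h
  have := trace_reflection hc
  rw [h, trace_neg, trace_one, Fintype.card_fin] at this
  have h2 : ((m : K) - 1) * 2 = 0 := by linear_combination -this
  rcases mul_eq_zero.mp h2 with h3 | h3
  · apply hm
    have : (m : K) = 1 := by linear_combination h3
    exact_mod_cast this
  · exact two_ne_zero h3

/-! ### The reflection as an element of `GL_m(K)`, and membership in `U(H)` and `SU(H)` -/

/-- The reflection as a unit of the matrix ring (it is its own inverse). -/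
def reflectionGL (H : Matrix (Fin m) (Fin m) K) (v : Fin m → K) (hc : hermDot H v v ≠ 0) :
    GL (Fin m) K :=
  ⟨reflection H v, reflection H v, reflection_mul_self hc, reflection_mul_self hc⟩

/-- The underlying matrix of `reflectionGL` is `reflection`. -/
@[simp] lemma coe_reflectionGL (H : Matrix (Fin m) (Fin m) K) (v : Fin m → K)
    (hc : hermDot H v v ≠ 0) : (reflectionGL H v hc : Matrix (Fin m) (Fin m) K) = reflection H v :=
  rfl

/-- `r_v * r_v = 1` in `GL_m(K)`. -/
theorem reflectionGL_mul_self (H : Matrix (Fin m) (Fin m) K) (v : Fin m → K)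
    (hc : hermDot H v v ≠ 0) : reflectionGL H v hc * reflectionGL H v hc = 1 :=
  Units.ext (reflection_mul_self hc)

/-- `r_v ∈ U(H)(K)`. -/
theorem reflectionGL_mem_unitaryGroup {H : Matrix (Fin m) (Fin m) K} (hH : IsHermitianForm K H)
    {v : Fin m → K} (hc : hermDot H v v ≠ 0) : reflectionGL H v hc ∈ unitaryGroup K H :=
  conjTransposeK_reflection_mul_mul hH hc

/-- `−r_v ∈ U(H)(K)` (the centre contains `−1`). -/
theorem neg_reflectionGL_mem_unitaryGroup {H : Matrix (Fin m) (Fin m) K} (hH : IsHermitianForm K H)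
    {v : Fin m → K} (hc : hermDot H v v ≠ 0) : -reflectionGL H v hc ∈ unitaryGroup K H := by
  have h : conjTransposeK K (-(reflection H v)) * H * (-(reflection H v)) = H := by
    rw [conjTransposeK_neg, neg_mul, neg_mul, mul_neg, neg_neg]
    exact conjTransposeK_reflection_mul_mul hH hc
  exact h

/-- `(−r_v) * (−r_v) = 1` in `GL_m(K)`. -/
theorem neg_reflectionGL_mul_self (H : Matrix (Fin m) (Fin m) K) (v : Fin m → K)
    (hc : hermDot H v v ≠ 0) : -reflectionGL H v hc * -reflectionGL H v hc = 1 := by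
  rw [neg_mul_neg]; exact reflectionGL_mul_self H v hc

/-- `−r_v ≠ 1` when `m ≠ 1`. -/
theorem neg_reflectionGL_ne_one {H : Matrix (Fin m) (Fin m) K} {v : Fin m → K}
    (hc : hermDot H v v ≠ 0) (hm : m ≠ 1) : -reflectionGL H v hc ≠ 1 := by
  intro h
  apply reflection_ne_neg_one hc hm
  have := congrArg Units.val h
  rw [Units.val_neg, coe_reflectionGL, Units.val_one] at this
  exact neg_eq_iff_eq_neg.mp this

/-- `r_v ≠ 1` in `GL_m(K)`. -/
theorem reflectionGL_ne_one {H : Matrix (Fin m) (Fin m) K} {v : Fin m → K}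
    (hc : hermDot H v v ≠ 0) : reflectionGL H v hc ≠ 1 := by
  intro h
  apply reflection_ne_one hc
  have := congrArg Units.val h
  rwa [coe_reflectionGL, Units.val_one] at this

/-- `det (−r_v) = 1` for `m = 3`: `−r_v ∈ SU(H)(K)`. -/
theorem neg_reflectionGL_mem_specialUnitaryGroup {H : Matrix (Fin 3) (Fin 3) K}
    (hH : IsHermitianForm K H) {v : Fin 3 → K} (hc : hermDot H v v ≠ 0) :
    -reflectionGL H v hc ∈ specialUnitaryGroup K H := by
  refine Subgroup.mem_inf.mpr ⟨neg_reflectionGL_mem_unitaryGroup hH hc, ?_⟩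
  rw [MonoidHom.mem_ker]
  apply Units.ext
  rw [Matrix.GeneralLinearGroup.val_det_apply, Units.val_neg, coe_reflectionGL, det_neg,
    det_reflection hc, Fintype.card_fin, Units.val_one]
  norm_num

/-- `−r_v` is an involution of `SU(H)(K)` different from `1`: for every hermitian `H ≠ 0` on `K³`
there is `δ ∈ SU(H)(K)` with `δ² = 1` and `δ ≠ 1`. -/
theorem exists_involution_mem_specialUnitaryGroup {H : Matrix (Fin 3) (Fin 3) K}
    (hH : IsHermitianForm K H) (h0 : H ≠ 0) :
    ∃ δ : GL (Fin 3) K, δ ∈ specialUnitaryGroup K H ∧ δ * δ = 1 ∧ δ ≠ 1 := by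
  obtain ⟨v, hc⟩ := exists_hermDot_self_ne_zero h0
  exact ⟨-reflectionGL H v hc, neg_reflectionGL_mem_specialUnitaryGroup hH hc,
    neg_reflectionGL_mul_self H v hc, neg_reflectionGL_ne_one hc (by decide)⟩

end

end Summit.Ventures.HodgeRepro2.ShimuraData
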